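import Summits.CriticalPhenomena.CardyFormulaZ2.Theorems.CardyIKTransportIKLinearTransportStubBoxResamplerGibbs
import Summits.CriticalPhenomena.CardyFormulaZ2.Theorems.CardyIKTransportIKLinearTransportStubBoxResamplerLaw

/-!
# Stub `stub_BoxResampler` (line `pinned-diagram-exchange`, crux stmt-CriticalPhenomena-5076) —
# part K: the resampling kernel of a box (geometry, measurability, kernel law, comparability)

Theorem-only support file (`--supports stmt-CriticalPhenomena-5076`, registered sub-goal
`boxResampler_frameBound`). For the box `B = [a, a+w) × [b, b+h)` with closure `B̄ = [a-1, a+w] × [b-1, b+h]`,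
layer `L = B̄ ∖ B`, interaction faces `VB = facesIn S B̄` (the `S`-faces meeting `B`) and inner faces
`F = {f | a ≤ f 0, f 0 + 1 < a + w, b ≤ f 1, f 1 + 1 < b + h}`, the resampler of the line is
`G x u = A x (s (λ x) u)`: `λ x` = the black layer cells of `x`, `s q` a black-box sampler (law
`(cornerGibbsMeasure tIK VB B 1_q ⊗ coinMeasure ½) ∘ toObs⁻¹`, part L), `A x y` = `y` on the box colours and the
inner-face flags, `x` elsewhere. No definition is introduced: the lemmas take `s, A, λ, G` with their defining
equations. Proved here: the frame bound `|VB ∖ facesIn S B| ≤ 2w + 2h + 4` (registered), measurability of `G`,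
the KERNEL LAW `β{u | G x u ∈ E} = (γ_{λ x} ⊗ coin){z' | A x (toObs z') ∈ E}`, its rewriting at `x = toObs z`
as the Gibbs resampling kernel of part G (boundary condition `z.1`, merge of colours on `B` and coins on `F`),
and the COMPARABILITY clause `β{G x · ∈ E} ≤ 256^{w+h+1} β{G x' · ∈ E}` for events `E` of the box data.
-/

noncomputable section

namespace Summit.CriticalPhenomena.CardyFormulaZ2.Theorems.IKLinearTransport.PinnedDiagramExchange
namespace BoxResampler

open scoped Classical BigOperators ENNReal NNReal MeasureTheory ProbabilityTheory
open MeasureTheory Set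
open Literature.Probability.LatticeModels Literature.Probability.Percolation
open Summit.CriticalPhenomena.CardyFormulaZ2.Cruxes.IKMixedBoxCrossing.DefectClosureExploration
  (boxLaw cellRect tIK coe_tIK facesIn antiFaces)
open Summit.CriticalPhenomena.CardyFormulaZ2.Cruxes.IKMixedBoxCrossing.DefectClosureExploration.BridgeOfLawStub
  (toObs measurable_toObs mem_cellRect)

/-! ## Geometry of boxes, faces and the frame bound -/

/-- The cells of the block of a face have coordinates `f i` or `f i + 1`. [folklore] -/
theorem cellFace_coords {f c : Site 2} (hc : c ∈ cellFace f) :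
    (c 0 = f 0 ∨ c 0 = f 0 + 1) ∧ (c 1 = f 1 ∨ c 1 = f 1 + 1) := by
  rcases mem_cellFace_iff.1 hc with rfl | rfl | rfl | rfl <;> simp

/-- The inner faces of a cell rectangle. [folklore] -/
theorem mem_innerVertices_cellRect {a b : ℤ} {W H : ℕ} {f : Site 2} :
    f ∈ innerVertices (cellRect a b W H) ↔ a ≤ f 0 ∧ f 0 + 1 < a + W ∧ b ≤ f 1 ∧ f 1 + 1 < b + H := by
  have h10 : (1 : Fin 2) ≠ 0 := by decide
  have h01 : (0 : Fin 2) ≠ 1 := by decide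
  rw [mem_innerVertices_iff, cellFace, Finset.insert_subset_iff, Finset.insert_subset_iff, Finset.insert_subset_iff,
    Finset.singleton_subset_iff]
  simp only [mem_cellRect, Pi.add_apply, Pi.one_apply, Pi.single_eq_same, Pi.single_eq_of_ne h10,
    Pi.single_eq_of_ne h01, add_zero]
  omega

/-- `facesIn` is monotone in the volume. [folklore] -/
theorem facesIn_mono (S : Set ℤ) {Λ Λ' : Finset (Site 2)} (h : Λ ⊆ Λ') : facesIn S Λ ⊆ facesIn S Λ' := by
  intro f hf
  simp only [facesIn, Finset.mem_filter, mem_innerVertices_iff] at hf ⊢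
  exact ⟨hf.1.trans h, hf.2⟩

/-- THE FRAME BOUND (registered sub-goal): the `S`-faces meeting the `w × h` box but not inside it number at most
`2w + 2h + 4` (they lie on the frame `f 0 ∈ {a-1, a+w-1} ∨ f 1 ∈ {b-1, b+h-1}`). [folklore] -/
theorem boxResampler_frameBound :
    ∀ (S : Set ℤ) (a b : ℤ) (w h : ℕ),
      (facesIn S (cellRect (a - 1) (b - 1) (w + 2) (h + 2)) \ facesIn S (cellRect a b w h)).card ≤
        2 * w + 2 * h + 4 := by
  intro S a b w h
  set A₁ : Finset (ℤ × ℤ) := ({a - 1, a + w - 1} : Finset ℤ) ×ˢ Finset.Icc (b - 1) (b + h - 1) with hA₁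
  set A₂ : Finset (ℤ × ℤ) := Finset.Icc (a - 1) (a + w - 1) ×ˢ ({b - 1, b + h - 1} : Finset ℤ) with hA₂
  have hsub : facesIn S (cellRect (a - 1) (b - 1) (w + 2) (h + 2)) \ facesIn S (cellRect a b w h) ⊆
      (A₁ ∪ A₂).image (fun p : ℤ × ℤ => (![p.1, p.2] : Site 2)) := fun f hf => by
    rw [Finset.mem_sdiff] at hf
    simp only [facesIn, Finset.mem_filter, mem_innerVertices_cellRect, not_and] at hf
    obtain ⟨⟨h1, hS⟩, h2⟩ := hf
    have h2' : ¬ (a ≤ f 0 ∧ f 0 + 1 < a + w ∧ b ≤ f 1 ∧ f 1 + 1 < b + h) := fun h' => h2 h' hS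
    simp only [Finset.mem_image, Finset.mem_union, hA₁, hA₂, Finset.mem_product, Finset.mem_insert,
      Finset.mem_singleton, Finset.mem_Icc]
    refine ⟨(f 0, f 1), ?_, Contour.site_ext rfl rfl⟩
    push_cast at h1 h2'
    omega
  have hI1 : (Finset.Icc (b - 1) (b + h - 1)).card = h + 1 := by rw [Int.card_Icc]; omega
  have hI2 : (Finset.Icc (a - 1) (a + w - 1)).card = w + 1 := by rw [Int.card_Icc]; omega
  calc (facesIn S (cellRect (a - 1) (b - 1) (w + 2) (h + 2)) \ facesIn S (cellRect a b w h)).card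
      ≤ ((A₁ ∪ A₂).image (fun p : ℤ × ℤ => (![p.1, p.2] : Site 2))).card := Finset.card_le_card hsub
    _ ≤ (A₁ ∪ A₂).card := Finset.card_image_le
    _ ≤ A₁.card + A₂.card := Finset.card_union_le _ _
    _ = ({a - 1, a + w - 1} : Finset ℤ).card * (h + 1) + (w + 1) * ({b - 1, b + h - 1} : Finset ℤ).card := by
        rw [hA₁, hA₂, Finset.card_product, Finset.card_product, hI1, hI2]
    _ ≤ 2 * (h + 1) + (w + 1) * 2 := by gcongr <;> exact Finset.card_le_two
    _ = 2 * w + 2 * h + 4 := by ring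

/-- The comparability constant: `t⁻² = 4/3 ≤ 4`, so `t^{-2M} ≤ 256^n` once `M ≤ 4n`. [folklore] -/
theorem tIK_inv_pow_le {M n : ℕ} (hM : M ≤ 4 * n) :
    ((tIK : ℝ≥0∞)⁻¹) ^ (2 * M) ≤ ENNReal.ofReal ((256 : ℝ) ^ n) := by
  have ht0 : (tIK : ℝ≥0) ≠ 0 := by
    rw [← NNReal.coe_ne_zero, coe_tIK]; positivity
  have hinv : (tIK : ℝ≥0)⁻¹ ≤ 2 := by
    rw [← NNReal.coe_le_coe, NNReal.coe_inv, coe_tIK, NNReal.coe_ofNat, inv_div,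
      div_le_iff₀ (Real.sqrt_pos.2 (by norm_num : (0 : ℝ) < 3))]
    nlinarith [Real.sq_sqrt (show (0 : ℝ) ≤ 3 by norm_num), Real.sqrt_nonneg 3]
  have h2 : ((tIK : ℝ≥0∞)⁻¹) ≤ 2 := by
    rw [← ENNReal.coe_inv ht0]
    exact_mod_cast hinv
  calc ((tIK : ℝ≥0∞)⁻¹) ^ (2 * M) ≤ (2 : ℝ≥0∞) ^ (2 * M) := pow_le_pow_left' h2 _
    _ ≤ (2 : ℝ≥0∞) ^ (8 * n) := pow_le_pow_right₀ one_le_two (by omega)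
    _ = ENNReal.ofReal ((256 : ℝ) ^ n) := by
        rw [ENNReal.ofReal_pow (by norm_num), show (256 : ℝ) = ((256 : ℕ) : ℝ) by norm_num,
          ENNReal.ofReal_natCast, pow_mul]
        norm_num

/-! ## The resampling map: measurability, kernel law, comparability -/

section Kernel

variable {S : Set ℤ} {a b : ℤ} {w h : ℕ}
  {s : Finset (Site 2) → Rnd → Obs} {A : Obs → Obs → Obs} {lam : Obs → Finset (Site 2)} {G : Obs → Rnd → Obs}
  (hsm : ∀ q, Measurable (s q))
  (hsl : ∀ q, β.map (s q) =
    ((cornerGibbsMeasure tIK (facesIn S (cellRect (a - 1) (b - 1) (w + 2) (h + 2))) (cellRect a b w h)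
      (fun v => decide (v ∈ q))).prod (coinMeasure half)).map (toObs S))
  (hA : ∀ x y, A x y =
    ({v | if a ≤ v 0 ∧ v 0 < a + w ∧ b ≤ v 1 ∧ v 1 < b + h then v ∈ y.1 else v ∈ x.1},
     {f | if a ≤ f 0 ∧ f 0 + 1 < a + w ∧ b ≤ f 1 ∧ f 1 + 1 < b + h then f ∈ y.2 else f ∈ x.2}))
  (hlam : ∀ x, lam x = (cellRect (a - 1) (b - 1) (w + 2) (h + 2) \ cellRect a b w h).filter (fun v => v ∈ x.1))
  (hG : ∀ x u, G x u = A x (s (lam x) u))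
  {F₀ : Set (Site 2)} (hF₀ : ∀ f : Site 2, f ∈ F₀ ↔ a ≤ f 0 ∧ f 0 + 1 < a + w ∧ b ≤ f 1 ∧ f 1 + 1 < b + h)

include hA in
/-- The merge map `A` is jointly measurable. [folklore] -/
theorem measurable_A : Measurable fun p : Obs × Obs => A p.1 p.2 := by
  rw [show (fun p : Obs × Obs => A p.1 p.2) = fun p =>
      ({v | if a ≤ v 0 ∧ v 0 < a + w ∧ b ≤ v 1 ∧ v 1 < b + h then v ∈ p.2.1 else v ∈ p.1.1},
       {f | if a ≤ f 0 ∧ f 0 + 1 < a + w ∧ b ≤ f 1 ∧ f 1 + 1 < b + h then f ∈ p.2.2 else f ∈ p.1.2})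
      from funext fun p => hA p.1 p.2]
  refine (measurable_set_iff.2 fun v => ?_).prodMk (measurable_set_iff.2 fun v => ?_)
  · simp only [mem_setOf_eq]
    split_ifs
    · exact (measurable_set_mem v).comp (measurable_fst.comp measurable_snd)
    · exact (measurable_set_mem v).comp (measurable_fst.comp measurable_fst)
  · simp only [mem_setOf_eq]
    split_ifs
    · exact (measurable_set_mem v).comp (measurable_snd.comp measurable_snd)
    · exact (measurable_set_mem v).comp (measurable_snd.comp measurable_fst)

include hlam in
/-- The layer statistic takes each of its (finitely many) values on a measurable set. [folklore] -/
theorem measurableSet_lam_eq (q : Finset (Site 2)) : MeasurableSet {x : Obs | lam x = q} := by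
  set Lf := cellRect (a - 1) (b - 1) (w + 2) (h + 2) \ cellRect a b w h with hLf
  by_cases hq : q ⊆ Lf
  · have hset : {x : Obs | lam x = q} = ⋂ v ∈ Lf, {x : Obs | v ∈ x.1 ↔ v ∈ q} := by
      ext x
      simp only [mem_setOf_eq, mem_iInter, hlam]
      constructor
      · intro hx v hv
        rw [← hx, Finset.mem_filter]
        exact ⟨fun h' => ⟨hv, h'⟩, fun h' => h'.2⟩
      · intro hx
        ext v
        rw [Finset.mem_filter]
        exact ⟨fun h' => (hx v h'.1).1 h'.2, fun h' => ⟨hq h', (hx v (hq h')).2 h'⟩⟩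
    rw [hset]
    refine Finset.measurableSet_biInter _ fun v _ => ?_
    by_cases hvq : v ∈ q
    · simp only [hvq, iff_true]
      exact measurable_fst (measurableSet_mem v)
    · simp only [hvq, iff_false]
      exact (measurable_fst (measurableSet_mem v)).compl
  · have hset : {x : Obs | lam x = q} = ∅ := by
      ext x
      simp only [mem_setOf_eq, mem_empty_iff_false, iff_false]
      exact fun hx => hq (hx ▸ (hlam x).symm ▸ Finset.filter_subset _ _)
    rw [hset]
    exact MeasurableSet.empty

include hsm hA hlam hG in
/-- The resampling map `G` is jointly measurable (finite decomposition along the values of the layer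
statistic). [folklore] -/
theorem measurable_G : Measurable (Function.uncurry G) := by
  set Lf := cellRect (a - 1) (b - 1) (w + 2) (h + 2) \ cellRect a b w h with hLf
  have hSmp : Measurable fun xu : Obs × Rnd => s (lam xu.1) xu.2 := by
    intro T hT
    have hset : (fun xu : Obs × Rnd => s (lam xu.1) xu.2) ⁻¹' T =
        ⋃ q ∈ Lf.powerset, ({x : Obs | lam x = q} ×ˢ ((s q) ⁻¹' T)) := by
      ext xu
      simp only [mem_preimage, mem_iUnion, mem_prod, mem_setOf_eq, exists_prop]
      constructor
      · intro hxu
        refine ⟨lam xu.1, Finset.mem_powerset.2 ?_, rfl, hxu⟩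
        rw [hlam]
        exact Finset.filter_subset _ _
      · rintro ⟨q, -, hq, hT'⟩
        rw [hq]; exact hT'
    rw [hset]
    exact Finset.measurableSet_biUnion _ fun q _ => (measurableSet_lam_eq hlam q).prod (hsm q hT)
  have heq : Function.uncurry G = (fun p : Obs × Obs => A p.1 p.2) ∘ fun xu : Obs × Rnd => (xu.1, s (lam xu.1) xu.2) := by
    funext xu
    simp only [Function.uncurry, Function.comp_apply, hG]
  rw [heq]
  exact (measurable_A hA).comp (measurable_fst.prodMk hSmp)

include hsm hsl hA hG in
/-- THE KERNEL LAW: for fixed `x`, the `β`-probability that `G x u ∈ E` is the mass of the `A x`-preimage of `E`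
under the finite Gibbs-with-coins law of the layer colours of `x`. [folklore] -/
theorem beta_apply_G (x : Obs) {E : Set Obs} (hE : MeasurableSet E) :
    β {u | G x u ∈ E} =
      ((cornerGibbsMeasure tIK (facesIn S (cellRect (a - 1) (b - 1) (w + 2) (h + 2))) (cellRect a b w h)
        (fun v => decide (v ∈ lam x))).prod (coinMeasure half)) {z' | A x (toObs S z') ∈ E} := by
  have hAx : Measurable (A x) := (measurable_A hA).comp (measurable_const.prodMk measurable_id)
  have hset : {u | G x u ∈ E} = (s (lam x)) ⁻¹' {y | A x y ∈ E} := by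
    ext u; simp only [mem_setOf_eq, mem_preimage, hG]
  have hE' : MeasurableSet {y | A x y ∈ E} := hAx hE
  rw [hset, ← Measure.map_apply (hsm _) hE', hsl, Measure.map_apply (measurable_toObs S) hE']
  rfl

include hA hF₀ in
/-- Merging at the level of observables is the observable of the merge of colourings and coins (`F₀` = the
inner faces). [folklore] -/
theorem A_toObs (z z' : CellConfig) :
    A (toObs S z) (toObs S z') = toObs S
      ((fun v => if v ∈ cellRect a b w h then z'.1 v else z.1 v), (fun v => if v ∈ F₀ then z'.2 v else z.2 v)) := by
  rw [hA]
  refine Prod.ext (Set.ext fun v => ?_) (Set.ext fun f => ?_)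
  · simp only [toObs, mem_setOf_eq]
    by_cases hv : a ≤ v 0 ∧ v 0 < a + w ∧ b ≤ v 1 ∧ v 1 < b + h
    · rw [if_pos hv, if_pos (mem_cellRect.2 hv)]
    · rw [if_neg hv, if_neg (fun h' => hv (mem_cellRect.1 h'))]
  · simp only [toObs, antiFaces, mem_setOf_eq]
    by_cases hf : a ≤ f 0 ∧ f 0 + 1 < a + w ∧ b ≤ f 1 ∧ f 1 + 1 < b + h
    · rw [if_pos hf, if_pos ((hF₀ f).2 hf)]
    · rw [if_neg hf, if_neg (fun h' => hf ((hF₀ f).1 h'))]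

include hlam in
/-- At `x = toObs S z` the indicator of the layer statistic agrees with `z.1` on the layer. [folklore] -/
theorem decide_mem_lam_toObs (z : CellConfig) {v : Site 2}
    (hv : v ∈ cellRect (a - 1) (b - 1) (w + 2) (h + 2) \ cellRect a b w h) :
    decide (v ∈ lam (toObs S z)) = z.1 v := by
  have hiff : v ∈ lam (toObs S z) ↔ z.1 v = true := by
    rw [hlam, Finset.mem_filter]
    exact ⟨fun h' => h'.2, fun h' => ⟨hv, h'⟩⟩
  by_cases hz : z.1 v = true
  · rw [hz]; exact decide_eq_true (hiff.2 hz)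
  · rw [Bool.not_eq_true] at hz
    rw [hz]; exact decide_eq_false fun h' => by rw [hiff, hz] at h'; exact Bool.false_ne_true h'

/-- CHANGE OF BOUNDARY CONDITION: the Gibbs-with-coins law of the box under two boundary conditions agreeing on
the layer gives the same mass to merged events (the fillings merged into `σ` do not read the boundary condition,
and the weights over `VB` read the layer only). [folklore] -/
theorem prod_gibbs_merge_congr (S : Set ℤ) (a b : ℤ) (w h : ℕ) {ξ ξ' : Site 2 → Bool}
    (hξ : ∀ v ∈ cellRect (a - 1) (b - 1) (w + 2) (h + 2) \ cellRect a b w h, ξ v = ξ' v)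
    (σ κ : Site 2 → Bool) (F : Set (Site 2)) {T : Set CellConfig} (hT : MeasurableSet T) :
    ((cornerGibbsMeasure tIK (facesIn S (cellRect (a - 1) (b - 1) (w + 2) (h + 2))) (cellRect a b w h) ξ).prod
        (coinMeasure half)) {z' | ((fun v => if v ∈ cellRect a b w h then z'.1 v else σ v),
          (fun v => if v ∈ F then z'.2 v else κ v)) ∈ T} =
    ((cornerGibbsMeasure tIK (facesIn S (cellRect (a - 1) (b - 1) (w + 2) (h + 2))) (cellRect a b w h) ξ').prod
        (coinMeasure half)) {z' | ((fun v => if v ∈ cellRect a b w h then z'.1 v else σ v),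
          (fun v => if v ∈ F then z'.2 v else κ v)) ∈ T} := by
  set Bx := cellRect a b w h with hBx
  set VB := facesIn S (cellRect (a - 1) (b - 1) (w + 2) (h + 2)) with hVB
  have hmrg : Measurable fun z' : CellConfig =>
      ((fun v => if v ∈ Bx then z'.1 v else σ v), (fun v => if v ∈ F then z'.2 v else κ v)) := by
    refine Measurable.prodMk (measurable_pi_lambda _ fun v => ?_) (measurable_pi_lambda _ fun v => ?_)
    · by_cases hv : v ∈ Bx
      · simp only [hv, if_true]; exact (measurable_pi_apply v).comp measurable_fst
      · simp only [hv, if_false]; exact measurable_const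
    · by_cases hv : v ∈ F
      · simp only [hv, if_true]; exact (measurable_pi_apply v).comp measurable_snd
      · simp only [hv, if_false]; exact measurable_const
  have hW : ∀ s : Finset (Site 2), cornerWeight tIK VB (boxFill Bx ξ s) = cornerWeight tIK VB (boxFill Bx ξ' s) := by
    intro s
    refine cornerWeight_congr tIK fun f hf c hc => ?_
    by_cases hcB : c ∈ Bx
    · rw [boxFill_apply_of_mem _ _ hcB, boxFill_apply_of_mem _ _ hcB]
    · rw [boxFill_apply_of_not_mem _ _ hcB, boxFill_apply_of_not_mem _ _ hcB]
      refine hξ c (Finset.mem_sdiff.2 ⟨?_, hcB⟩)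
      simp only [hVB, facesIn, Finset.mem_filter, mem_innerVertices_iff] at hf
      exact hf.1 hc
  have hZ : cornerPartitionFunction tIK VB Bx ξ = cornerPartitionFunction tIK VB Bx ξ' :=
    Finset.sum_congr rfl fun s _ => hW s
  have hfill : ∀ (η : Site 2 → Bool) (s : Finset (Site 2)) (v : Site 2),
      (if v ∈ Bx then boxFill Bx η s v else σ v) = boxFill Bx σ s v := fun η s v => by
    by_cases hv : v ∈ Bx
    · rw [if_pos hv, boxFill_apply_of_mem _ _ hv, boxFill_apply_of_mem _ _ hv]
    · rw [if_neg hv, boxFill_apply_of_not_mem _ _ hv]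
  have hsecEq : ∀ s : Finset (Site 2),
      Prod.mk (boxFill Bx ξ s) ⁻¹' ((fun z' : CellConfig =>
        ((fun v => if v ∈ Bx then z'.1 v else σ v), (fun v => if v ∈ F then z'.2 v else κ v))) ⁻¹' T) =
      Prod.mk (boxFill Bx ξ' s) ⁻¹' ((fun z' : CellConfig =>
        ((fun v => if v ∈ Bx then z'.1 v else σ v), (fun v => if v ∈ F then z'.2 v else κ v))) ⁻¹' T) :=
    fun s => Set.ext fun κ' => by simp only [mem_preimage, hfill]
  rw [show {z' : CellConfig | ((fun v => if v ∈ Bx then z'.1 v else σ v), (fun v => if v ∈ F then z'.2 v else κ v)) ∈ T} =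
      (fun z' : CellConfig => ((fun v => if v ∈ Bx then z'.1 v else σ v), (fun v => if v ∈ F then z'.2 v else κ v))) ⁻¹' T
      from rfl,
    prod_cornerGibbs_apply tIK VB Bx ξ _ (hmrg hT), prod_cornerGibbs_apply tIK VB Bx ξ' _ (hmrg hT), hZ]
  refine congrArg (fun X => (cornerPartitionFunction tIK VB Bx ξ')⁻¹ * X) (Finset.sum_congr rfl fun s _ => ?_)
  rw [hW s, hsecEq s]

include hsm hsl hA hlam hG hF₀ in
/-- THE KERNEL LAW AT `x = toObs S z`, in the form of part G: boundary condition `z.1`, colours merged on the box,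
coins merged on the inner faces `F₀`. [folklore] -/
theorem beta_apply_G_toObs (z : CellConfig) {D : Set Obs} (hD : MeasurableSet D) :
    β {u | G (toObs S z) u ∈ D} =
      ((cornerGibbsMeasure tIK (facesIn S (cellRect (a - 1) (b - 1) (w + 2) (h + 2))) (cellRect a b w h) z.1).prod
        (coinMeasure half)) {z' | ((fun v => if v ∈ cellRect a b w h then z'.1 v else z.1 v),
          (fun v => if v ∈ F₀ then z'.2 v else z.2 v)) ∈ toObs S ⁻¹' D} := by
  rw [beta_apply_G hsm hsl hA hG (toObs S z) hD,
    show {z' : CellConfig | A (toObs S z) (toObs S z') ∈ D} =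
      {z' | ((fun v => if v ∈ cellRect a b w h then z'.1 v else z.1 v),
        (fun v => if v ∈ F₀ then z'.2 v else z.2 v)) ∈ toObs S ⁻¹' D} from
      Set.ext fun z' => by rw [mem_setOf_eq, A_toObs hA hF₀]; rfl]
  exact prod_gibbs_merge_congr S a b w h (fun v hv => decide_mem_lam_toObs hlam z hv) z.1 z.2 F₀
    (measurable_toObs S hD)

include hsm hsl hA hG in
/-- THE COMPARABILITY CLAUSE: for an event `E` of the box data (box colours, inner-face flags) the
`β`-probabilities of `{G x · ∈ E}` for two inputs differ by at most the factor `256^{w+h+1}` (two boundary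
conditions change each Gibbs weight and the normalisation by at most `t^{∓M}`, `M ≤ 2w + 2h + 4` the frame
bound). [folklore] -/
theorem beta_apply_G_le (x x' : Obs) {E : Set Obs} (hE : MeasurableSet E)
    (hdet : ∀ y y' : Obs, (∀ v : Site 2, a ≤ v 0 ∧ v 0 < a + w ∧ b ≤ v 1 ∧ v 1 < b + h → (v ∈ y.1 ↔ v ∈ y'.1)) →
      (∀ f : Site 2, a ≤ f 0 ∧ f 0 + 1 < a + w ∧ b ≤ f 1 ∧ f 1 + 1 < b + h → (f ∈ y.2 ↔ f ∈ y'.2)) →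
      (y ∈ E ↔ y' ∈ E)) :
    β {u | G x u ∈ E} ≤ ENNReal.ofReal ((256 : ℝ) ^ (w + h + 1)) * β {u | G x' u ∈ E} := by
  set Bx := cellRect a b w h with hBx
  set VB := facesIn S (cellRect (a - 1) (b - 1) (w + 2) (h + 2)) with hVB
  have hAx : ∀ x : Obs, Measurable (A x) := fun x => (measurable_A hA).comp (measurable_const.prodMk measurable_id)
  -- the two preimages coincide (the event reads the box data only, which `A` takes from its second argument)
  have hAgree : ∀ (x₁ x₂ : Obs) (y : Obs), (A x₁ y ∈ E ↔ A x₂ y ∈ E) := fun x₁ x₂ y => by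
    refine hdet _ _ (fun v hv => ?_) (fun f hf => ?_)
    · simp only [hA, mem_setOf_eq, if_pos hv]
    · simp only [hA, mem_setOf_eq, if_pos hf]
  have hT : {z' : CellConfig | A x (toObs S z') ∈ E} = {z' | A x' (toObs S z') ∈ E} :=
    Set.ext fun z' => hAgree x x' _
  rw [beta_apply_G hsm hsl hA hG x hE, beta_apply_G hsm hsl hA hG x' hE, hT]
  -- sections at the fillings do not read the boundary condition
  have hsec : ∀ (ξ ξ' : Site 2 → Bool) (s : Finset (Site 2)) (κ : Site 2 → Bool),
      A x' (toObs S (boxFill Bx ξ s, κ)) = A x' (toObs S (boxFill Bx ξ' s, κ)) := by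
    intro ξ ξ' s κ
    rw [hA, hA]
    refine Prod.ext (Set.ext fun v => ?_) rfl
    simp only [mem_setOf_eq, toObs]
    split_ifs with hv
    · rw [boxFill_apply_of_mem _ _ (mem_cellRect.2 hv), boxFill_apply_of_mem _ _ (mem_cellRect.2 hv)]
    · rfl
  have hVin : facesIn S Bx ⊆ VB := facesIn_mono S fun v hv => by
    rw [mem_cellRect] at hv ⊢; push_cast; omega
  have hin : ∀ f ∈ facesIn S Bx, cellFace f ⊆ Bx := fun f hf =>
    mem_innerVertices_iff.1 (Finset.mem_filter.1 hf).1
  have ht0 : (tIK : ℝ≥0) ≠ 0 := by rw [← NNReal.coe_ne_zero, coe_tIK]; positivity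
  have ht1 : (tIK : ℝ≥0) ≤ 1 := by
    rw [← NNReal.coe_le_coe, coe_tIK, NNReal.coe_one, div_le_one (by norm_num : (0 : ℝ) < 2)]
    nlinarith [Real.sq_sqrt (show (0 : ℝ) ≤ 3 by norm_num), Real.sqrt_nonneg 3]
  have hTm : MeasurableSet {z' : CellConfig | A x' (toObs S z') ∈ E} := (hAx x').comp (measurable_toObs S) hE
  refine (prod_cornerGibbs_le_of_sections ht0 ht1 hVin hin (fun v => decide (v ∈ lam x))
    (fun v => decide (v ∈ lam x')) (coinMeasure half) hTm fun s _ => ?_).trans ?_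
  · refine congrArg (coinMeasure half) (Set.ext fun κ => ?_)
    simp only [mem_preimage, mem_setOf_eq, hsec (fun v => decide (v ∈ lam x)) (fun v => decide (v ∈ lam x'))]
  · gcongr
    exact tIK_inv_pow_le ((boxResampler_frameBound S a b w h).trans (by omega))

end Kernel

end BoxResampler
end Summit.CriticalPhenomena.CardyFormulaZ2.Theorems.IKLinearTransport.PinnedDiagramExchange

end
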